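import Summits.KontsevichZagierPeriods.Zeta5Search.WellPoisedFaceTailOddWindow
import Summits.KontsevichZagierPeriods.Zeta5Search.WellPoisedFaceOddGrowthFree
import HarnessLib

/-!
# Odd-zeta search — the face forms with `B` tail bricks, part 4: THE PARITY RULE
# (which zeta values survive is decided by the parity of `B·(h₀ − 1)`; cell `pub-zeta5`, fam-odd gen 10)

HONEST FRAMING: systematic search; no irrationality claim unless certified.

Sequel to `WellPoisedFaceTailLinearFormsPF` / `WellPoisedFaceTailLinearForms` / `WellPoisedFaceTailOddWindow`
(fam-odd gen 9).  There, for Zudilin's face form `F(h_n) = ½ Σ_{t≥0} R″(t)` (`tailF η₀ η n`) with `B ≥ 3` tail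
bricks on an integral face direction (`2η_j < η₀`, `h₀ = η₀ n + 2`, `h_j = η_j n + 1`), `tailF_linearForm` records
that the `ζ(o+3)`-coefficient vanishes whenever `B(η₀ n + 1) + o` is odd (the reflection
`R(−t − h₀) = (−1)^{B(h₀−1)+1} R(t)`, `tailRQ_reflect`), and `tailF_linearForm_odd` draws the conclusion for EVEN `B`
(the boxes `q = B + 3 = 7, 9, 11`).  This file states the rule for EVERY `B` — the cell's "parity rule" for even `q`
(families/odd/FAMILY.md §1, checked there in exact arithmetic, §3) as a kernel theorem:

* §T8 `tailF_linearForm_parity`: `F(h_n) = Σ_{3 < s ≤ B+2, B(h₀−1)+s odd} A_s ζ(s) − A₀` with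
  `D_{η₀n}^{B+2−s} A_s ∈ ℤ`, `D_{η₀n}^{B+2} A₀ ∈ ℤ` (no `ζ(3)` ever);
  `tailF_linearForm_odd_of_even` (`B(h₀−1)` EVEN ⇒ only the ODD `ζ(5), ζ(7), …` survive) and
  `tailF_linearForm_even_of_odd` (`B(h₀−1)` ODD ⇒ only the EVEN `ζ(4), ζ(6), …` survive: the odd zeta values
  DROP OUT and the form says nothing about them);
* for an ODD number of bricks (`q = 8, 10`: the even-`q` members of the `{ζ5,ζ7}` / `{ζ5,ζ7,ζ9}` lanes, FAMILY.md
  §5.2 `κ₈`, `κ₁₀`): on the subsequence `η₀ n` odd (i.e. `h₀` odd) the window is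
  the odd one `{5, 7, …, B+2}` (`tailF_linearForm_odd_of_oddMul`, any `B`); `tailF_linearForm_even_of_oddB` — for `η₀ n` even it is `{4, 6, …, B+1}`;
  `tailF_intForm_of_ratForm` clears the denominators (`D^{B+2}·F ∈ ℤ + Σ ℤζ(s)`);
* §T9 the integral face directions `E : IntFaceDir M` (`q = M + 5`, `B = M + 2`) with `M` ODD (`q = 8, 10`):
  `IntFaceDir.tailF_linearForm_odd_of_oddMul` / `faceLambda_tailF_mem_ratSpan_of_oddMul` (`η₀ n` odd: the normalised
  forms `Λ_n`, which GROW by gen 8's hypothesis-free `faceLambda_faceForm_tendsto_atTop` for `M ≤ 6`, lie in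
  `ℚ + ℚζ(5) + … + ℚζ(M+4)`) and `IntFaceDir.tailF_linearForm_even_of_odd` (`η₀ n` even: `ℚ + ℚζ(4) + … + ℚζ(M+3)`);
  kernel instances `q = 8` (the symmetric direction `(3; 0³, 1⁵)` in both parities, and an integral direction
  `(51; 0³, 15,…,19)` whose forms grow and alternate between the two windows).

With gen 8 (growth, `1 ≤ M ≤ 6`) and gen 9 (even `B`) this completes the kernel meaning of the face no-go for EVERY
box `q ≤ 11` of [Zudilin2004, §8] with `r = 3`: whatever the parity, the face forms are rational linear forms in `1`
and zeta values of ONE parity inside the window, with lcm-denominators, and their integer normalisations grow — they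
prove nothing about `ζ(5)`, `ζ(7)`, `ζ(9)` (nor about `ζ(4)`, `ζ(6)`, …).  Standard axioms only.
-/

noncomputable section

open Finset Filter Topology

namespace Summit.KontsevichZagierPeriods.Zeta5Search.WellPoisedFaceRate

open Literature.NumberTheory.Transcendental (zetaValue)
open Summit.KontsevichZagierPeriods.Zeta5Search.DualSeriesDenominators (natCast_dvd_lcmUpto)

variable {B : ℕ} (η₀ : ℕ) (η : Fin B → ℕ) (n : ℕ)

/-! ## T8. The window by parity -/

/-- **THE PARITY RULE.**  For `B ≥ 3` tail bricks on an integral face direction and every `n`: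
`F(h_n) = Σ_{3 < s ≤ B+2, B(η₀n+1)+s odd} A_s ζ(s) − A₀` with `D_{η₀n}^{B+2−s} A_s ∈ ℤ`, `D_{η₀n}^{B+2} A₀ ∈ ℤ`
(`h₀ − 1 = η₀ n + 1`).  The surviving weights all have the parity opposite to `B(h₀−1)`; `ζ(3)` never occurs. -/
theorem tailF_linearForm_parity (hB : 3 ≤ B) (hη : ∀ j, 2 * η j < η₀) :
    ∃ A : ℕ → ℚ, ∃ A₀ : ℚ,
      tailF η₀ η n = (∑ s ∈ (Ioc 3 (B + 2)).filter (fun s => Odd (B * (η₀ * n + 1) + s)),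
          (A s : ℝ) * zetaValue s) - (A₀ : ℝ) ∧
      (∀ s, ∃ z : ℤ, (Nat.lcmUpto (η₀ * n) : ℚ) ^ (B + 2 - s) * A s = z) ∧
      (∃ z : ℤ, (Nat.lcmUpto (η₀ * n) : ℚ) ^ (B + 2) * A₀ = z) := by
  obtain ⟨c, hint, hF, h0, hpar⟩ := tailF_linearForm η₀ η n hB hη
  generalize B * (η₀ * n + 1) = P at hpar ⊢
  refine ⟨fun s => tailCoef (η₀ * n) c (s - 3), tailConst (η₀ * n) B c, ?_, fun s => ?_,
    tailConst_den _ _ _ (fun k hk1 hk2 => natCast_dvd_lcmUpto hk1 hk2) c hint⟩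
  · have hre : ∑ s ∈ Ico 3 (B + 3), (tailCoef (η₀ * n) c (s - 3) : ℝ) * zetaValue s
        = ∑ o ∈ range B, (tailCoef (η₀ * n) c o : ℝ) * zetaValue (o + 3) := by
      rw [Finset.sum_Ico_eq_sum_range, Nat.add_sub_cancel]
      refine sum_congr rfl fun o _ => ?_
      rw [Nat.add_sub_cancel_left, add_comm 3 o]
    have hsub : (Ioc 3 (B + 2)).filter (fun s => Odd (P + s)) ⊆ Ico 3 (B + 3) := by
      intro x hx
      rw [mem_filter, mem_Ioc] at hx
      rw [mem_Ico]
      omega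
    have hvan : ∀ x ∈ Ico 3 (B + 3), x ∉ (Ioc 3 (B + 2)).filter (fun s => Odd (P + s)) →
        (tailCoef (η₀ * n) c (x - 3) : ℝ) * zetaValue x = 0 := by
      intro x hx hx'
      rw [mem_Ico] at hx
      rw [mem_filter, mem_Ioc] at hx'
      by_cases h3 : x = 3
      · subst h3
        rw [Nat.sub_self, h0, Rat.cast_zero, zero_mul]
      · have hev : ¬Odd (P + x) := fun hodd => hx' ⟨⟨by omega, by omega⟩, hodd⟩
        have hodd : Odd (P + (x - 3)) := by
          rw [Nat.not_odd_iff_even, Nat.even_iff] at hev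
          rw [Nat.odd_iff]
          omega
        rw [hpar (x - 3) (by omega) hodd, Rat.cast_zero, zero_mul]
    beta_reduce
    rw [hF, ← hre, Finset.sum_subset hsub hvan]
  · beta_reduce
    by_cases hs : s ≤ 3
    · refine ⟨0, ?_⟩
      rw [show s - 3 = 0 by omega, h0, mul_zero, Int.cast_zero]
    · rw [show B + 2 - s = B - 1 - (s - 3) by omega]
      exact tailCoef_den _ _ _ c hint (s - 3)

/-- `B(η₀n+1)` EVEN ⇒ the ODD window: `F(h_n) = Σ_{s odd, 5 ≤ s ≤ B+2} A_s ζ(s) − A₀` (no `ζ(3)`, no even zeta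
value).  Contains gen 9's `tailF_linearForm_odd` (`B` even) and the odd-`B` boxes on the subsequence `η₀ n` odd. -/
theorem tailF_linearForm_odd_of_even (hB : 3 ≤ B) (hpe : Even (B * (η₀ * n + 1))) (hη : ∀ j, 2 * η j < η₀) :
    ∃ A : ℕ → ℚ, ∃ A₀ : ℚ,
      tailF η₀ η n = (∑ s ∈ (Ioc 3 (B + 2)).filter Odd, (A s : ℝ) * zetaValue s) - (A₀ : ℝ) ∧
      (∀ s, ∃ z : ℤ, (Nat.lcmUpto (η₀ * n) : ℚ) ^ (B + 2 - s) * A s = z) ∧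
      (∃ z : ℤ, (Nat.lcmUpto (η₀ * n) : ℚ) ^ (B + 2) * A₀ = z) := by
  obtain ⟨A, A₀, hF, hA, hA₀⟩ := tailF_linearForm_parity η₀ η n hB hη
  have hfilt : (Ioc 3 (B + 2)).filter (fun s => Odd (B * (η₀ * n + 1) + s)) = (Ioc 3 (B + 2)).filter Odd :=
    Finset.filter_congr fun s _ => by
      rw [Nat.odd_add']
      exact ⟨fun h => h.mpr hpe, fun h => ⟨fun _ => hpe, fun _ => h⟩⟩
  exact ⟨A, A₀, by rw [hF, hfilt], hA, hA₀⟩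

/-- `B(η₀n+1)` ODD ⇒ the EVEN window: `F(h_n) = Σ_{s even, 4 ≤ s ≤ B+2} A_s ζ(s) − A₀` — the ODD zeta values
DROP OUT (FAMILY.md §3: `q = 8`, `h₀ = 52` even ⇒ only `ζ(4)`, `ζ(6)`), so such members say nothing about them. -/
theorem tailF_linearForm_even_of_odd (hB : 3 ≤ B) (hpo : Odd (B * (η₀ * n + 1))) (hη : ∀ j, 2 * η j < η₀) :
    ∃ A : ℕ → ℚ, ∃ A₀ : ℚ,
      tailF η₀ η n = (∑ s ∈ (Ioc 3 (B + 2)).filter Even, (A s : ℝ) * zetaValue s) - (A₀ : ℝ) ∧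
      (∀ s, ∃ z : ℤ, (Nat.lcmUpto (η₀ * n) : ℚ) ^ (B + 2 - s) * A s = z) ∧
      (∃ z : ℤ, (Nat.lcmUpto (η₀ * n) : ℚ) ^ (B + 2) * A₀ = z) := by
  obtain ⟨A, A₀, hF, hA, hA₀⟩ := tailF_linearForm_parity η₀ η n hB hη
  have hfilt : (Ioc 3 (B + 2)).filter (fun s => Odd (B * (η₀ * n + 1) + s)) = (Ioc 3 (B + 2)).filter Even :=
    Finset.filter_congr fun s _ => by
      rw [Nat.odd_add]
      exact ⟨fun h => h.mp hpo, fun h => ⟨fun _ => h, fun _ => hpo⟩⟩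
  exact ⟨A, A₀, by rw [hF, hfilt], hA, hA₀⟩

/-- `η₀ n` odd (`h₀ = η₀n + 2` odd) ⇒ the ODD window, WHATEVER the number of bricks — in particular for ODD `B`
(`q = 8, 10`: the even-`q` boxes) on that subsequence the window is `{5, 7, …, B+2}`. -/
theorem tailF_linearForm_odd_of_oddMul (hB : 3 ≤ B) (hn : Odd (η₀ * n)) (hη : ∀ j, 2 * η j < η₀) :
    ∃ A : ℕ → ℚ, ∃ A₀ : ℚ,
      tailF η₀ η n = (∑ s ∈ (Ioc 3 (B + 2)).filter Odd, (A s : ℝ) * zetaValue s) - (A₀ : ℝ) ∧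
      (∀ s, ∃ z : ℤ, (Nat.lcmUpto (η₀ * n) : ℚ) ^ (B + 2 - s) * A s = z) ∧
      (∃ z : ℤ, (Nat.lcmUpto (η₀ * n) : ℚ) ^ (B + 2) * A₀ = z) := by
  refine tailF_linearForm_odd_of_even η₀ η n hB ?_ hη
  obtain ⟨k, hk⟩ := hn
  exact ⟨B * (k + 1), by rw [hk]; ring⟩

/-- ODD `B`, `η₀ n` even (`h₀` even): the EVEN window `{4, 6, …, B+1}` — the odd zeta values drop out. -/
theorem tailF_linearForm_even_of_oddB (hB : 3 ≤ B) (hBo : Odd B) (hn : Even (η₀ * n))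
    (hη : ∀ j, 2 * η j < η₀) :
    ∃ A : ℕ → ℚ, ∃ A₀ : ℚ,
      tailF η₀ η n = (∑ s ∈ (Ioc 3 (B + 2)).filter Even, (A s : ℝ) * zetaValue s) - (A₀ : ℝ) ∧
      (∀ s, ∃ z : ℤ, (Nat.lcmUpto (η₀ * n) : ℚ) ^ (B + 2 - s) * A s = z) ∧
      (∃ z : ℤ, (Nat.lcmUpto (η₀ * n) : ℚ) ^ (B + 2) * A₀ = z) :=
  tailF_linearForm_even_of_odd η₀ η n hB (hBo.mul hn.add_one) hη

/-- Clearing denominators: a rational form with `d^{B+2−s} A_s ∈ ℤ`, `d^{B+2} A₀ ∈ ℤ` over weights `s ≤ B + 2`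
becomes an INTEGER form after multiplication by `d^{B+2}`. -/
theorem tailF_intForm_of_ratForm {S : Finset ℕ} (hS : ∀ s ∈ S, s ≤ B + 2) {F : ℝ} {d : ℕ} {A : ℕ → ℚ} {A₀ : ℚ}
    (hF : F = (∑ s ∈ S, (A s : ℝ) * zetaValue s) - (A₀ : ℝ))
    (hA : ∀ s, ∃ z : ℤ, (d : ℚ) ^ (B + 2 - s) * A s = z) (hA₀ : ∃ z : ℤ, (d : ℚ) ^ (B + 2) * A₀ = z) :
    ∃ a : ℕ → ℤ, ∃ b : ℤ, (d : ℝ) ^ (B + 2) * F = (∑ s ∈ S, (a s : ℝ) * zetaValue s) - (b : ℝ) := by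
  obtain ⟨zb, hzb⟩ := hA₀
  choose za hza using hA
  refine ⟨fun s => (d : ℤ) ^ s * za s, zb, ?_⟩
  have eb : (d : ℝ) ^ (B + 2) * (A₀ : ℝ) = (zb : ℝ) := by
    have := congrArg (fun q : ℚ => (q : ℝ)) hzb
    push_cast at this
    exact this
  beta_reduce
  rw [hF, mul_sub, eb, mul_sum]
  congr 1
  refine sum_congr rfl fun s hs => ?_
  have ea : (d : ℝ) ^ (B + 2 - s) * (A s : ℝ) = (za s : ℝ) := by
    have := congrArg (fun q : ℚ => (q : ℝ)) (hza s)
    push_cast at this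
    exact this
  rw [show (d : ℝ) ^ (B + 2) = (d : ℝ) ^ s * (d : ℝ) ^ (B + 2 - s) by
    rw [← pow_add, Nat.add_sub_cancel' (hS s hs)]]
  push_cast
  rw [← ea]
  ring

/-- Kernel instance, `q = 8` (the even-`q` member of the `{ζ5, ζ7}` lane), symmetric direction `(3; 0³, 1⁵)`,
`n` ODD (`h₀ = 3n + 2` odd): `D_{3n}⁷ · F_n = a₅ ζ(5) + a₇ ζ(7) − b` with `a₅, a₇, b ∈ ℤ`. -/
example (n : ℕ) (hn : Odd n) : ∃ a : ℕ → ℤ, ∃ b : ℤ,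
    ((Nat.lcmUpto (3 * n) : ℝ)) ^ 7 * tailF 3 ![1, 1, 1, 1, 1] n
      = (a 5 : ℝ) * zetaValue 5 + (a 7 : ℝ) * zetaValue 7 - (b : ℝ) := by
  obtain ⟨A, A₀, hF, hA, hA₀⟩ := tailF_linearForm_odd_of_oddMul 3 ![1, 1, 1, 1, 1] n (by norm_num)
    ((by decide : Odd 3).mul hn) (by decide)
  obtain ⟨a, b, h⟩ := tailF_intForm_of_ratForm (B := 5)
    (fun s hs => by rw [mem_filter, mem_Ioc] at hs; omega) hF hA hA₀
  refine ⟨a, b, ?_⟩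
  rw [h, show (Ioc 3 (5 + 2)).filter Odd = {5, 7} by decide, sum_pair (by norm_num)]

/-- Same direction, `n` EVEN (`h₀` even): `D_{3n}⁷ · F_n = a₄ ζ(4) + a₆ ζ(6) − b` — the odd zeta values have
dropped out (FAMILY.md §3's exact check, now for every even `n`). -/
example (n : ℕ) (hn : Even n) : ∃ a : ℕ → ℤ, ∃ b : ℤ,
    ((Nat.lcmUpto (3 * n) : ℝ)) ^ 7 * tailF 3 ![1, 1, 1, 1, 1] n
      = (a 4 : ℝ) * zetaValue 4 + (a 6 : ℝ) * zetaValue 6 - (b : ℝ) := by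
  obtain ⟨A, A₀, hF, hA, hA₀⟩ := tailF_linearForm_even_of_oddB 3 ![1, 1, 1, 1, 1] n (by norm_num) ⟨2, rfl⟩
    (hn.mul_left 3) (by decide)
  obtain ⟨a, b, h⟩ := tailF_intForm_of_ratForm (B := 5)
    (fun s hs => by rw [mem_filter, mem_Ioc] at hs; omega) hF hA hA₀
  refine ⟨a, b, ?_⟩
  rw [h, show (Ioc 3 (5 + 2)).filter Even = {4, 6} by decide, sum_pair (by norm_num)]

end Summit.KontsevichZagierPeriods.Zeta5Search.WellPoisedFaceRate

/-! ## T9. Integral face directions with an ODD number of middle bricks (`IntFaceDir M`, `M` odd: `q = 8, 10`) -/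

namespace Summit.KontsevichZagierPeriods.Zeta5Search.WellPoisedFace.IntFaceDir

open Literature.NumberTheory.Transcendental (zetaValue)
open Summit.KontsevichZagierPeriods.Zeta5Search.WellPoisedFaceRate (tailF)

variable {M : ℕ} (E : IntFaceDir M)

/-- `q = M + 5`, `M ≥ 1`, on the subsequence `η₀ n` odd: the ODD window whatever the parity of `M` (for `M` even
gen 9's `tailF_linearForm_odd` gives it for every `n`; the point here is `M` ODD, `q = 8, 10`) —
`F(h_n) = Σ_{s odd, 5 ≤ s ≤ M+4} A_s ζ(s) − A₀`, `D_{η₀n}^{M+4−s} A_s ∈ ℤ`, `D_{η₀n}^{M+4} A₀ ∈ ℤ`. -/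
theorem tailF_linearForm_odd_of_oddMul (hM1 : 1 ≤ M) (n : ℕ) (hn : Odd (E.η₀ * n)) :
    ∃ A : ℕ → ℚ, ∃ A₀ : ℚ,
      tailF E.η₀ E.tail n = (∑ s ∈ (Ioc 3 (M + 4)).filter Odd, (A s : ℝ) * zetaValue s) - (A₀ : ℝ) ∧
      (∀ s, ∃ z : ℤ, (Nat.lcmUpto (E.η₀ * n) : ℚ) ^ (M + 4 - s) * A s = z) ∧
      (∃ z : ℤ, (Nat.lcmUpto (E.η₀ * n) : ℚ) ^ (M + 4) * A₀ = z) :=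
  WellPoisedFaceRate.tailF_linearForm_odd_of_oddMul E.η₀ E.tail n (by omega) hn
    fun j => lt_of_le_of_lt (Nat.mul_le_mul_left 2 (E.hhi j)) E.hd

/-- `M` odd, `η₀ n` even: the EVEN window `{4, 6, …, M+3}` — these members carry no odd zeta value at all. -/
theorem tailF_linearForm_even_of_odd (hMo : Odd M) (n : ℕ) (hn : Even (E.η₀ * n)) :
    ∃ A : ℕ → ℚ, ∃ A₀ : ℚ,
      tailF E.η₀ E.tail n = (∑ s ∈ (Ioc 3 (M + 4)).filter Even, (A s : ℝ) * zetaValue s) - (A₀ : ℝ) ∧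
      (∀ s, ∃ z : ℤ, (Nat.lcmUpto (E.η₀ * n) : ℚ) ^ (M + 4 - s) * A s = z) ∧
      (∃ z : ℤ, (Nat.lcmUpto (E.η₀ * n) : ℚ) ^ (M + 4) * A₀ = z) :=
  WellPoisedFaceRate.tailF_linearForm_even_of_oddB E.η₀ E.tail n (by have := hMo.pos; omega)
    (hMo.add_even even_two) hn
    fun j => lt_of_le_of_lt (Nat.mul_le_mul_left 2 (E.hhi j)) E.hd

/-- **COROLLARY.** `M ≥ 1`, `η₀ n` odd: the normalised face forms `Λ_n = D·Φ⁻¹·F_n` (`E.faceLambda`; they grow for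
`M ≤ 6` by gen 8's `faceLambda_faceForm_tendsto_atTop`) lie in `ℚ + ℚζ(5) + ℚζ(7) + … + ℚζ(M+4)`. -/
theorem faceLambda_tailF_mem_ratSpan_of_oddMul (hM1 : 1 ≤ M) (n : ℕ) (hn : Odd (E.η₀ * n)) :
    ∃ u : ℕ → ℚ, ∃ v : ℚ, E.faceLambda (tailF E.η₀ E.tail) n
      = (∑ s ∈ (Ioc 3 (M + 4)).filter Odd, (u s : ℝ) * zetaValue s) - (v : ℝ) := by
  obtain ⟨A, A₀, hF, -, -⟩ := E.tailF_linearForm_odd_of_oddMul hM1 n hn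
  refine ⟨fun s => (E.faceD n : ℚ) / (E.facePhi n : ℚ) * A s, (E.faceD n : ℚ) / (E.facePhi n : ℚ) * A₀, ?_⟩
  beta_reduce
  rw [faceLambda, hF, mul_sub, mul_sum]
  push_cast
  congr 1
  exact sum_congr rfl fun s _ => by ring

/-- An integral direction of the `q = 8` face (`M = 3`, five tail bricks): `(51; 0,0,0, 15,16,17,18,19)`. -/
def face8Int : IntFaceDir 3 where
  η₀ := 51
  tail := ![15, 16, 17, 18, 19]
  hlo := by decide
  hhi := by decide
  hd := by decide

/-- Its normalised forms GROW (gen 8, hypothesis-free, `M = 3 ≤ 6`) … -/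
example : Tendsto (fun n : ℕ => |face8Int.faceLambda face8Int.faceForm n|) atTop atTop :=
  face8Int.faceLambda_faceForm_tendsto_atTop (by norm_num) (by norm_num)

/-- … and ALTERNATE between the two windows: `n` odd (`h₀ = 51n + 2` odd) ⇒ `Λ_n ∈ ℚ + ℚζ(5) + ℚζ(7)` … -/
example (n : ℕ) (hn : Odd n) : ∃ u : ℕ → ℚ, ∃ v : ℚ, face8Int.faceLambda (tailF face8Int.η₀ face8Int.tail) n
    = (u 5 : ℝ) * zetaValue 5 + (u 7 : ℝ) * zetaValue 7 - (v : ℝ) := by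
  obtain ⟨u, v, h⟩ := face8Int.faceLambda_tailF_mem_ratSpan_of_oddMul (by norm_num) n ((by decide : Odd 51).mul hn)
  refine ⟨u, v, ?_⟩
  rw [h, show (Ioc 3 (3 + 4)).filter Odd = {5, 7} by decide, sum_pair (by norm_num)]

/-- … `n` even ⇒ `F(h_n) ∈ ℚ + ℚζ(4) + ℚζ(6)`: no odd zeta value at all. -/
example (n : ℕ) (hn : Even n) : ∃ A : ℕ → ℚ, ∃ A₀ : ℚ, tailF face8Int.η₀ face8Int.tail n
    = (A 4 : ℝ) * zetaValue 4 + (A 6 : ℝ) * zetaValue 6 - (A₀ : ℝ) := by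
  obtain ⟨A, A₀, h, -, -⟩ := face8Int.tailF_linearForm_even_of_odd ⟨1, rfl⟩ n (hn.mul_left 51)
  refine ⟨A, A₀, ?_⟩
  rw [h, show (Ioc 3 (3 + 4)).filter Even = {4, 6} by decide, sum_pair (by norm_num)]

end Summit.KontsevichZagierPeriods.Zeta5Search.WellPoisedFace.IntFaceDir
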